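import Summits.HodgeConjecture.HodgeConjecture.Theorems.Ring2WeilCoverageCMFieldCompositeSexticCarriers
import HarnessLib

/-!
# Ring 2 — Weil-type family-coverage census, CM-field rows (X-AG): the NON-GALOIS sextic carrier `F₁₄₈(i)`
# (`F₁₄₈ = ℚ[y]/(y³ − y² − 3y + 1)`, disc 148) in the kernel — roots located by the intermediate value theorem —
# and its rational rows `[q] = [1] ⟺ q = x² + y²`, prime rows `[ℓ] = [1] ⟺ ℓ = 2 ∨ ℓ ≡ 1 (mod 4)`

HONEST FRAMING: research route conditional on HC_CM; not a corollary; Q11.4-sentence-2 already refuted in dim ≥ 3.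

Cell `pub-hodge-ring2`, seat `ring2-b03` (gen 59), census `WEIL-FAMILY-COVERAGE.md` «## b03» b03.24 P.S. (cell (xviii′), the
last of the six sextic census fields of b03.23). `E = F₁₄₈(i)`, `η = iθ` with `θ` a root of `y³ − y² − 3y + 1`,
`σ = η² = −θ²`: carrier `R₁₄₈ = S³ + 7S² + 11S + 1` (the minimal polynomial of `−θ²`). Here `F` is NOT abelian over `ℚ`
(Galois closure `S₃`), so the roots of `R` cannot be read off a cyclotomic host as in parts X-V/X-AE; they are
LOCATED instead: `R(−5) = −4 < 0 < 5 = R(−4)`, `R(−3) = 4 > 0 > −1 = R(−2)` give two real roots `r₁ ≠ r₂`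
(intermediate value theorem), and for any complex root `s`, `R(s) − R(rᵢ) = (s − rᵢ)·qᵢ(s)` with
`q₁(s) − q₂(s) = (r₁ − r₂)(s + r₁ + r₂ + 7)` forces `s ∈ {r₁, r₂, −7 − r₁ − r₂} ⊂ ℝ`; positivity of the coefficients
then gives `s < 0`. Irreducibility: no root mod `3`. Then parts X-AD (the `Fact` for `E`), X-AC (rational rows,
`t = (σ+3)/(σ+1)`, `σt² = −1`) and X-AE §1 (prime rows for `K = ℚ(i)`) apply:

* `R148_irreducible_int`, `R148_fact_realPolyQ`, **`R148_roots_real_neg`**, `R148_fact_cmPolyQ`,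
  `R148_root_mul_sq_eq_neg_one`, **`R148_mk_eq_split_iff`**, **`R148_mk_prime_eq_split_iff`**.

READING vs the table of b03.23 (3): `F₁₄₈(i)`: rational classes `[19], [23], [3], [31], [43]` (primes `≡ 3 (mod 4)`, each
with `T(ℓ)` inside `S6`), `[57] = [3·19]`; 10 of the 32 classes have a rational representative `≤ 400` ✓.
THEOREMS ONLY: no `def`, no named fact, no `sorry`; `HC_CM` does not occur; nothing about the Hodge conjecture is asserted.

## References
* [Deligne1982HodgeCycles] P. Deligne (notes by J. S. Milne), LNM 900 (1982), §4 p. 30 (1), Cor. 4.2.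
* [Cox2013] D. A. Cox, *Primes of the form x² + ny²*, 2nd ed., §1 (1.1).
-/

noncomputable section

set_option linter.dupNamespace false

open Polynomial

namespace Summit.HodgeConjecture.HodgeConjecture.Ring2.WeilCoverageCM

open Literature.AlgebraicGeometry.Deligne1982
open Literature.AlgebraicGeometry.HodgeTheory (splitDiscriminantClassCM)

/-! ### The carrier `R₁₄₈ = S³ + 7S² + 11S + 1` of `F₁₄₈(i)` -/

/-- `S³ + 7S² + 11S + 1` is irreducible over `ℤ`: monic with no root mod `3` (`S³ + S² + 2S + 1`). [folklore] -/
theorem R148_irreducible_int : Irreducible (X ^ 3 + C (7 : ℤ) * X ^ 2 + C 11 * X + C 1 : Polynomial ℤ) := by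
  have hmonic : (X ^ 3 + C (7 : ℤ) * X ^ 2 + C 11 * X + C 1 : Polynomial ℤ).Monic := by monicity!
  refine hmonic.irreducible_of_irreducible_map (Int.castRingHom (ZMod 3)) _ ?_
  have hmap : Polynomial.map (Int.castRingHom (ZMod 3)) (X ^ 3 + C (7 : ℤ) * X ^ 2 + C 11 * X + C 1) =
      X ^ 3 + X ^ 2 + C 2 * X + 1 := by
    simp only [Polynomial.map_add, Polynomial.map_mul, Polynomial.map_pow, map_X, map_C]
    have h7 : (Int.castRingHom (ZMod 3)) 7 = 1 := by decide
    have h11 : (Int.castRingHom (ZMod 3)) 11 = 2 := by decide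
    have h1 : (Int.castRingHom (ZMod 3)) 1 = 1 := by decide
    rw [h7, h11, h1, C_1, one_mul]
  rw [hmap]
  have hm3 : (X ^ 3 + X ^ 2 + C 2 * X + 1 : Polynomial (ZMod 3)).Monic := by monicity!
  have hd3 : (X ^ 3 + X ^ 2 + C 2 * X + 1 : Polynomial (ZMod 3)).natDegree = 3 := by compute_degree!
  rw [hm3.irreducible_iff_roots_eq_zero_of_degree_le_three (by rw [hd3]; norm_num) (by rw [hd3])]
  refine Multiset.eq_zero_of_forall_notMem fun a ha => ?_
  rw [mem_roots hm3.ne_zero, IsRoot.def, eval_add, eval_add, eval_add, eval_pow, eval_pow, eval_mul, eval_C, eval_X,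
    eval_one] at ha
  fin_cases a <;> revert ha <;> decide

/-- The `Fact` for `F₁₄₈ = ℚ[S]/(S³ + 7S² + 11S + 1)` (Gauss). [folklore] -/
theorem R148_fact_realPolyQ :
    Fact (Irreducible (realPolyQ (X ^ 3 + C 7 * X ^ 2 + C 11 * X + C 1 : Polynomial ℤ))) := by
  refine ⟨?_⟩
  have hmonic : (X ^ 3 + C (7 : ℤ) * X ^ 2 + C 11 * X + C 1 : Polynomial ℤ).Monic := by monicity!
  have h := (hmonic.irreducible_iff_irreducible_map_fraction_map (K := ℚ)).1 R148_irreducible_int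
  rwa [algebraMap_int_eq] at h

/-- **The roots of `S³ + 7S² + 11S + 1` are real and negative** — by ROOT LOCATION: the intermediate value theorem gives
real roots `r₁ ∈ [−5, −4]`, `r₂ ∈ [−3, −2]`; for a complex root `s`, `(s − rᵢ)·(s² + s rᵢ + rᵢ² + 7(s + rᵢ) + 11) = 0`
(`i = 1, 2`) and `q₁ − q₂ = (r₁ − r₂)(s + r₁ + r₂ + 7)`, so `s ∈ {r₁, r₂, −7 − r₁ − r₂}` is real; a real root of a
polynomial with positive coefficients is negative. [folklore] -/
theorem R148_roots_real_neg :
    ∀ s : ℂ, Polynomial.eval₂ (Int.castRingHom ℂ) s (X ^ 3 + C 7 * X ^ 2 + C 11 * X + C 1 : Polynomial ℤ) = 0 →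
      s.im = 0 ∧ s.re < 0 := by
  -- two real roots by the intermediate value theorem
  have hcont : Continuous fun x : ℝ => x ^ 3 + 7 * x ^ 2 + 11 * x + 1 := by fun_prop
  obtain ⟨r₁, hr₁I, hr₁⟩ : ∃ r ∈ Set.Icc (-5 : ℝ) (-4), r ^ 3 + 7 * r ^ 2 + 11 * r + 1 = 0 := by
    have h := intermediate_value_Icc (show (-5 : ℝ) ≤ -4 by norm_num) hcont.continuousOn
    exact h ⟨by norm_num, by norm_num⟩
  obtain ⟨r₂, hr₂I, hr₂⟩ : ∃ r ∈ Set.Icc (-3 : ℝ) (-2), r ^ 3 + 7 * r ^ 2 + 11 * r + 1 = 0 := by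
    have h := intermediate_value_Icc' (show (-3 : ℝ) ≤ -2 by norm_num) hcont.continuousOn
    exact h ⟨by norm_num, by norm_num⟩
  have hne : (r₁ : ℂ) - r₂ ≠ 0 := by
    rw [sub_ne_zero, Ne, Complex.ofReal_inj]
    intro h
    rw [h] at hr₁I
    exact absurd (le_trans hr₂I.1 hr₁I.2) (by norm_num)
  have hr₁' : (r₁ : ℂ) ^ 3 + 7 * (r₁ : ℂ) ^ 2 + 11 * r₁ + 1 = 0 := by exact_mod_cast hr₁
  have hr₂' : (r₂ : ℂ) ^ 3 + 7 * (r₂ : ℂ) ^ 2 + 11 * r₂ + 1 = 0 := by exact_mod_cast hr₂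
  intro s hs
  simp only [eval₂_add, eval₂_mul, eval₂_pow, eval₂_X, eval₂_ofNat, eval₂_one, eq_intCast, Int.cast_ofNat,
    Int.cast_one] at hs
  -- `s` is real
  have hsim : s.im = 0 := by
    have e1 : (s - r₁) * (s ^ 2 + s * r₁ + r₁ ^ 2 + 7 * (s + r₁) + 11) = 0 := by linear_combination hs - hr₁'
    have e2 : (s - r₂) * (s ^ 2 + s * r₂ + r₂ ^ 2 + 7 * (s + r₂) + 11) = 0 := by linear_combination hs - hr₂'
    by_cases h1 : s = r₁
    · rw [h1]; exact Complex.ofReal_im r₁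
    by_cases h2 : s = r₂
    · rw [h2]; exact Complex.ofReal_im r₂
    have q1 := (mul_eq_zero.1 e1).resolve_left (sub_ne_zero.2 h1)
    have q2 := (mul_eq_zero.1 e2).resolve_left (sub_ne_zero.2 h2)
    have h3 : ((r₁ : ℂ) - r₂) * (s + r₁ + r₂ + 7) = 0 := by linear_combination q1 - q2
    have h4 : s = (((-7 - r₁ - r₂ : ℝ)) : ℂ) := by
      have := (mul_eq_zero.1 h3).resolve_left hne
      push_cast
      linear_combination this
    rw [h4]
    exact Complex.ofReal_im _
  refine ⟨hsim, ?_⟩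
  have hsr : s = (s.re : ℂ) := Complex.ext (by simp) (by simp [hsim])
  rw [hsr] at hs
  have hC : ((s.re ^ 3 + 7 * s.re ^ 2 + 11 * s.re + 1 : ℝ) : ℂ) = 0 := by
    push_cast
    exact hs
  have hr : s.re ^ 3 + 7 * s.re ^ 2 + 11 * s.re + 1 = 0 := Complex.ofReal_eq_zero.mp hC
  by_contra hge
  have h0 : 0 ≤ s.re := not_lt.mp hge
  nlinarith [mul_nonneg (mul_nonneg h0 h0) h0, mul_nonneg h0 h0]

/-- The `Fact` for `E = ℚ[T]/(T⁶ + 7T⁴ + 11T² + 1) = F₁₄₈(i)` — by part X-AD. [folklore] -/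
theorem R148_fact_cmPolyQ : Fact (Irreducible (cmPolyQ (X ^ 3 + C 7 * X ^ 2 + C 11 * X + C 1 : Polynomial ℤ))) :=
  haveI := R148_fact_realPolyQ
  fact_irreducible_cmPolyQ_of_roots_real_neg (by monicity!) R148_roots_real_neg

section R148

variable {R : Polynomial ℤ} [Fact (Irreducible (realPolyQ R))]

/-- **`i ∈ F₁₄₈(i)` on the carrier: `t = (σ+3)/(σ+1)` has `σt² = −1`** (`σ(σ+3)² + (σ+1)² = R₁₄₈(σ) = 0`; `t = 1/θ`,
`θ = (θ² − 1)/(θ² − 3)`). [cite: Deligne1982HodgeCycles, §4 p. 30] -/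
theorem R148_root_mul_sq_eq_neg_one (hR : R = X ^ 3 + C 7 * X ^ 2 + C 11 * X + C 1) :
    AdjoinRoot.root (realPolyQ R) *
        ((AdjoinRoot.root (realPolyQ R) + 3) / (AdjoinRoot.root (realPolyQ R) + 1)) ^ 2 =
      AdjoinRoot.of (realPolyQ R) (-1) := by
  have hRQ : realPolyQ R = X ^ 3 + C (7 : ℚ) * X ^ 2 + C (11 : ℚ) * X + C (1 : ℚ) := by
    have h := realPolyQ_eq_of_cubic R hR
    push_cast at h
    exact h
  have hσ := root_rel_of_realPolyQ_eq hRQ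
  simp only [map_ofNat, map_one] at hσ
  have hne : AdjoinRoot.root (realPolyQ R) + 1 ≠ 0 := by
    intro h0
    have hm1 : AdjoinRoot.root (realPolyQ R) = -1 := by linear_combination h0
    rw [hm1] at hσ
    norm_num at hσ
  rw [map_neg, map_one, div_pow, ← mul_div_assoc, div_eq_iff (pow_ne_zero 2 hne)]
  linear_combination hσ

end R148

/-- **The rational rows of `W12.F₁₄₈(i)`: `[q] = [(−1)²] = [1] ⟺ q = x² + y²` for some `x, y ∈ ℚ`** (part X-AC with
`K = ℚ(i)`; valid although `F₁₄₈/ℚ` is not Galois; stated on the literal carrier with its instances from this file).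
Table of b03.23: `[19], [23], [3], [31], [43], [57]` non-split. [cite: Deligne1982HodgeCycles, §4 p. 30 (1) and Cor. 4.2] -/
theorem R148_mk_eq_split_iff :
    haveI := R148_fact_realPolyQ
    ∀ {c : ℚ} (q : (realField (X ^ 3 + C 7 * X ^ 2 + C 11 * X + C 1 : Polynomial ℤ))ˣ),
      (q : realField (X ^ 3 + C 7 * X ^ 2 + C 11 * X + C 1 : Polynomial ℤ)) = AdjoinRoot.of _ c →
      ((QuotientGroup.mk q : cmNormResidueGroup (X ^ 3 + C 7 * X ^ 2 + C 11 * X + C 1 : Polynomial ℤ)) =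
          splitDiscriminantClassCM (X ^ 3 + C 7 * X ^ 2 + C 11 * X + C 1 : Polynomial ℤ) 2 ↔
        ∃ x y : ℚ, c = x ^ 2 + y ^ 2) := by
  haveI := R148_fact_realPolyQ
  haveI := R148_fact_cmPolyQ
  intro c q hq
  have hodd : Odd (X ^ 3 + C 7 * X ^ 2 + C 11 * X + C 1 : Polynomial ℤ).natDegree :=
    ⟨1, by rw [(monic_and_natDegree_of_cubic (X ^ 3 + C 7 * X ^ 2 + C 11 * X + C 1 : Polynomial ℤ) rfl).2]; rfl⟩
  rw [mk_eq_splitDiscriminantClassCM_two_iff_of_odd hodd one_pos _ (R148_root_mul_sq_eq_neg_one rfl) q hq]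
  simp only [one_mul]

/-- **The class of every prime in the `F₁₄₈(i)` table: `[ℓ] = [1] ⟺ ℓ = 2 ∨ ℓ ≡ 1 (mod 4)`** (literal carrier).
[cite: Cox2013, §1 (1.1)] [cite: Deligne1982HodgeCycles, §4 Cor. 4.2] -/
theorem R148_mk_prime_eq_split_iff :
    haveI := R148_fact_realPolyQ
    ∀ {ℓ : ℕ}, ℓ.Prime → ∀ (q : (realField (X ^ 3 + C 7 * X ^ 2 + C 11 * X + C 1 : Polynomial ℤ))ˣ),
      (q : realField (X ^ 3 + C 7 * X ^ 2 + C 11 * X + C 1 : Polynomial ℤ)) = AdjoinRoot.of _ (ℓ : ℚ) →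
      ((QuotientGroup.mk q : cmNormResidueGroup (X ^ 3 + C 7 * X ^ 2 + C 11 * X + C 1 : Polynomial ℤ)) =
          splitDiscriminantClassCM (X ^ 3 + C 7 * X ^ 2 + C 11 * X + C 1 : Polynomial ℤ) 2 ↔ (ℓ = 2 ∨ ℓ % 4 = 1)) := by
  haveI := R148_fact_realPolyQ
  haveI := R148_fact_cmPolyQ
  intro ℓ hℓ q hq
  have hodd : Odd (X ^ 3 + C 7 * X ^ 2 + C 11 * X + C 1 : Polynomial ℤ).natDegree :=
    ⟨1, by rw [(monic_and_natDegree_of_cubic (X ^ 3 + C 7 * X ^ 2 + C 11 * X + C 1 : Polynomial ℤ) rfl).2]; rfl⟩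
  exact mk_prime_eq_split_iff_of_neg_one hodd _ (R148_root_mul_sq_eq_neg_one rfl) hℓ q hq


end Summit.HodgeConjecture.HodgeConjecture.Ring2.WeilCoverageCM

end
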